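import Mathlib
import Summits.Ventures.PercRepro2.SwOutJunctionH1Orbit
import Summits.Ventures.PercRepro2.SwOutBlocks
import Summits.Ventures.PercRepro2.SwOutSevThmDefs

/-!
# THEOREM A_sev: the rigid inequality on every several-arms junction class (blind cell
PercRepro2, night-4 g22, 2026-08-27; proofs/NIGHT4-G22.md §6)

A base region `U ∋ h` (`l ∉ U`) with a JUNCTION `u` whose neighbours are adjacent to `h` or are
DROPPED VERTICES `p r` (`MixedJunctionR`: several arms, each a dropped vertex with its h-piece,
pure arms among them), the mark `o` outside the components of the dropped vertices.  THE KEY of a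
`Q`-point (`keyR`) and THE BLOCKS (`blockOfR`): the coarse orbit of an out point or of an
escaping point of the plain kind, the block `blockR` of the RE-TYPED data of a core-kind point
(the arms with a red dead edge at the canonical base absorbed as u-arms, the others mixed with
their pieces — `mixedBaseR_of_coreKindR`), which also owns the escaping points of the mixed kind
(`MixedKindER`).  Every `Q`-point lies in the block of its key (`mem_blockOfR_keyR`), every
`Q`-point of that block lies in the class with the same key (`keyR_eq_of_mem_blockOfR`: along a
block the core points keep the data — `mixedDataR_realR_core` — and the slab points are escaping
points of the mixed kind whose data are read off by `baseER` — `baseER_esc`; along a plain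
orbit no core-kind point and no mixed-kind point can appear, the orbit of a core-free block point
staying in the block — `exists_mixedRealR_of_mem_orbit`), and every block satisfies the rigid
inequality (`card_blockOfR_le`: `card_orbit_le`, `card_blockR_le` = `rigid_block_plus`);
`rigidOK_of_blocks` assembles them: **`rigidOK_of_mixedJunctionR`**.
-/

namespace Summit.Ventures.PercRepro2

namespace MixedArms

open Hull LocRows BigBlock

variable {V : Type*} {E : Type*} [Fintype E] [DecidableEq E]

open scoped Classical

variable {ends : E → Sym2 V} {ρ : Type*} [Fintype ρ] {U : Set V} {ξ : Config E} {l h o u : V}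
  {p : ρ → V}

section Thm

variable (hj : MixedJunctionR ends U h u p o) (hl : l ∉ U)
  (ho : ∀ r, o ∉ compU ends U h u (p r))
include hj hl ho

section Block

variable {ζ : Config E} (hζ : ζ ∈ swOutSide ends l h o U ξ) (hk : CoreKind ends U h u ζ)
include hζ hk

omit ho in
/-- The realisation of a non-leaking point lies in the outside class. -/
theorem realR_mem_outClass {q : PtR (mixedDataR ends h u p ζ).ι (mixedDataR ends h u p ζ).ρ'
    (mixedDataR ends h u p ζ).ν (mixedDataR ends h u p ζ).κ} (hq : ¬ Leak q (mixedDataR ends h u p ζ).arm) :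
    mixedRealR ends u (mixedDataR ends h u p ζ).U ((mixedDataR ends h u p ζ).drop p)
      (mixedDataR ends h u p ζ).Ah (mixedDataR ends h u p ζ).F (coreBaseOf ends ζ h u) q ∈
      outClass ends U h ξ := by
  have hb := mixedBaseR_of_coreKindR hj hl hζ hk
  have hup : ∀ r : (mixedDataR ends h u p ζ).ρ', ∃ e, ends e = s(u, (mixedDataR ends h u p ζ).drop p r) :=
    fun r => hj.hup r.1
  have hHU : extHull ends ζ h u ⊆ U := extHull_subset_of_coreKind hζ hk
  obtain ⟨hqR, hqB⟩ := not_leak_iff_RB.1 hq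
  rw [mem_outClass]
  refine ⟨fun e he => ?_, fun x hx => ?_⟩
  · have hne : e ∉ flipSetR ends u (mixedDataR ends h u p ζ).U ((mixedDataR ends h u p ζ).drop p)
        (mixedDataR ends h u p ζ).Ah (mixedDataR ends h u p ζ).F q :=
      fun h' => he (mem_touches_U_of_mem_flipSetR hj hζ hk h')
    unfold mixedRealR
    rw [if_neg hne, coreBaseOf_agree_R hζ hk he]
    exact (mem_outClass.1 (mem_swOutSide.1 hζ).2).1 e he
  · have hx' := hb.hull_mixedRealR_subset hup hqR hqB hx
    rw [← extHull_eq_structure hj hl hζ hk] at hx'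
    exact hHU hx'

/-- **The key is constant along the `Q`-points of the block of a core-kind point.** -/
theorem keyR_eq_of_mem_blockR_core {ζ' : Config E}
    (hζ' : ζ' ∈ blockR ends u p (mixedDataR ends h u p ζ))
    (hQ : ζ' ∈ tgtU ends l h {S : Set V | o ∈ S}) :
    ζ' ∈ swOutSide ends l h o U ξ ∧ keyR ends U ξ l h o u p ζ' = Sum.inr (mixedDataR ends h u p ζ) := by
  obtain ⟨q, hq, hqζ⟩ := mem_blockR.1 hζ'
  rw [mixedDataR_base] at hqζ
  subst hqζ
  have hb := mixedBaseR_of_coreKindR hj hl hζ hk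
  haveI := nonempty_ι_of_coreKind hj hl hζ hk
  have hup : ∀ r : (mixedDataR ends h u p ζ).ρ', ∃ e, ends e = s(u, (mixedDataR ends h u p ζ).drop p r) :=
    fun r => hj.hup r.1
  obtain ⟨hqR, hqB⟩ := not_leak_iff_RB.1 hq
  have hcl := realR_mem_outClass hj hl hζ hk hq
  refine ⟨mem_swOutSide.2 ⟨hQ, hcl⟩, ?_⟩
  by_cases hcore : Core q (mixedDataR ends h u p ζ).arm
  · have hk' := coreKind_realR_core hj hl hζ hk hcore
    rw [keyR_of_core hk'.1 hk'.2, mixedDataR_realR_core hj hl hζ hk hcore]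
  · -- a slab point: escaping of the mixed kind, its data read off by `baseER`
    have hslab : TSlab q (mixedDataR ends h u p ζ).arm ∨ BSlab q (mixedDataR ends h u p ζ).arm := by
      rcases (not_leak_iff (mixedDataR ends h u p ζ).arm q).1 hq with hc | hs
      · exact absurd hc hcore
      · exact hs
    have hu' : u ∈ hull ends (mixedRealR ends u (mixedDataR ends h u p ζ).U
        ((mixedDataR ends h u p ζ).drop p) (mixedDataR ends h u p ζ).Ah (mixedDataR ends h u p ζ).F
        (coreBaseOf ends ζ h u) q) h := hb.u_mem_hull_R hup hqR hqB
    have hesc := hb.not_hull_u_subset_of_not_core hup (dataExt hj hζ hk) (dataPieceOut hj hζ hk ho)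
      (dataAh_dead ζ) hslab hcore
    have hHU : extHull ends ζ h u ⊆ U := extHull_subset_of_coreKind hζ hk
    have huU : u ∈ U := hk.2 (Or.inl (mem_cluster_self _ _ _))
    have hAU : ∀ i, (mixedDataR ends h u p ζ).Ah i ⊆ U := fun i x hx =>
      hHU (mem_extHull_of_mem_armsAllR hj (Or.inl (Or.inr (Set.mem_iUnion.2 ⟨i, hx⟩)))).1
    have hbase := hb.baseER_esc hup (dataP_red hj hl hζ hk) (dataP_blue hj hl hζ hk) (fun r e he => dataUP₀ (ζ := ζ) r e he)
      (fun r e he => dataX₀ hj (ζ := ζ) r e he) hslab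
    have hdata : mixedDataR ends h u p ζ = mixedDataR ends h u p (baseER ends U h u p
        (mixedRealR ends u (mixedDataR ends h u p ζ).U ((mixedDataR ends h u p ζ).drop p)
          (mixedDataR ends h u p ζ).Ah (mixedDataR ends h u p ζ).F (coreBaseOf ends ζ h u) q)) := by
      rw [hbase, mixedDataR_coreBaseOf hj hl hζ hk]
    have hm : MixedKindER ends U ξ l h o u p (mixedRealR ends u (mixedDataR ends h u p ζ).U
        ((mixedDataR ends h u p ζ).drop p) (mixedDataR ends h u p ζ).Ah (mixedDataR ends h u p ζ).F
        (coreBaseOf ends ζ h u) q) :=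
      ⟨ζ, hζ, hk, hdata, hζ'⟩
    rw [keyR_of_escMixed hu' hesc hm, ← hdata]

end Block

omit ho in
/-- **An escaping `Q`-point in the coarse orbit of a core-free point of the block of a core-kind
`Q`-point is of the mixed kind.** -/
theorem mixedKindER_of_mem_orbit {ζ₀ : Config E} (hζ₀ : ζ₀ ∈ swOutSide ends l h o U ξ)
    (hk₀ : CoreKind ends U h u ζ₀) {ζ' : Config E}
    (hζ' : ζ' ∈ blockR ends u p (mixedDataR ends h u p ζ₀)) (hc' : CoreFree ends ζ' h)
    {ζ : Config E} (hesc : ¬ hull ends ζ u ⊆ U)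
    (hζorb : ζ ∈ orbit ends (allRed ends ζ' h) h) : MixedKindER ends U ξ l h o u p ζ := by
  obtain ⟨q, hq, hqζ⟩ := mem_blockR.1 hζ'
  rw [mixedDataR_base] at hqζ
  subst hqζ
  have hb := mixedBaseR_of_coreKindR hj hl hζ₀ hk₀
  haveI := nonempty_ι_of_coreKind hj hl hζ₀ hk₀
  have hup : ∀ r : (mixedDataR ends h u p ζ₀).ρ', ∃ e, ends e = s(u, (mixedDataR ends h u p ζ₀).drop p r) :=
    fun r => hj.hup r.1
  obtain ⟨q', hq', hζeq⟩ := hb.exists_mixedRealR_of_mem_orbit hup (dataAh_dead ζ₀)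
    (dataU_conn_within hj ζ₀) (dataAh_conn_within ζ₀) (dataF_conn_within ζ₀) hq hc' hζorb
  by_cases hcore : Core q' (mixedDataR ends h u p ζ₀).arm
  · exfalso
    have hk' := coreKind_realR_core hj hl hζ₀ hk₀ hcore
    rw [← hζeq] at hk'
    exact hesc hk'.2
  · have hslab : TSlab q' (mixedDataR ends h u p ζ₀).arm ∨ BSlab q' (mixedDataR ends h u p ζ₀).arm := by
      rcases (not_leak_iff (mixedDataR ends h u p ζ₀).arm q').1 hq' with hc | hs
      · exact absurd hc hcore
      · exact hs
    have hHU : extHull ends ζ₀ h u ⊆ U := extHull_subset_of_coreKind hζ₀ hk₀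
    have huU : u ∈ U := hk₀.2 (Or.inl (mem_cluster_self _ _ _))
    have hAU : ∀ i, (mixedDataR ends h u p ζ₀).Ah i ⊆ U := fun i x hx =>
      hHU (mem_extHull_of_mem_armsAllR hj (Or.inl (Or.inr (Set.mem_iUnion.2 ⟨i, hx⟩)))).1
    have hbase := hb.baseER_esc hup (dataP_red hj hl hζ₀ hk₀) (dataP_blue hj hl hζ₀ hk₀) (fun r e he => dataUP₀ (ζ := ζ₀) r e he)
      (fun r e he => dataX₀ hj (ζ := ζ₀) r e he) hslab
    refine ⟨ζ₀, hζ₀, hk₀, ?_, mem_blockR.2 ⟨q', hq', hζeq.symm⟩⟩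
    rw [hζeq, hbase, mixedDataR_coreBaseOf hj hl hζ₀ hk₀]

omit ho in
/-- **Every `Q`-point lies in the block of its key.** -/
theorem mem_blockOfR_keyR {ζ : Config E} (hζ : ζ ∈ swOutSide ends l h o U ξ) :
    ζ ∈ blockOfR ends h u p (keyR ends U ξ l h o u p ζ) := by
  by_cases hu : u ∉ hull ends ζ h
  · rw [keyR_of_out hu]
    exact (orbitKind_block hl hj.hloop_h hj.hout hζ hu).1
  rw [not_not] at hu
  by_cases hk : hull ends ζ u ⊆ U
  · rw [keyR_of_core hu hk]
    exact mem_blockR.2 ⟨qOfR ends h u p ζ, not_leak_of_core' (core_qOfR ζ),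
      mixedRealR_coreBaseOf_R hj hl hζ ⟨hu, hk⟩⟩
  by_cases hm : MixedKindER ends U ξ l h o u p ζ
  · rw [keyR_of_escMixed hu hk hm]
    obtain ⟨ζ₀, -, -, hdata, hmem⟩ := hm
    show ζ ∈ blockR ends u p (mixedDataR ends h u p (baseER ends U h u p ζ))
    rw [← hdata]
    exact hmem
  · rw [keyR_of_plain hu hk hm]
    have hc : CoreFree ends ζ h := coreFree_of_escaping hj.hout hζ hk
    obtain ⟨ω, hω⟩ := exists_orbitReal_eq (ζ₀ := allRed ends ζ h) hc rfl
    show ζ ∈ orbit ends (allRed ends ζ h) h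
    simp only [orbit, Finset.mem_image, Finset.mem_univ, true_and]
    exact ⟨ω, hω⟩

/-- **Every `Q`-point of the block of a `Q`-point lies in the class with the same key.** -/
theorem keyR_eq_of_mem_blockOfR {ζ : Config E} (hζ : ζ ∈ swOutSide ends l h o U ξ) {ζ' : Config E}
    (hζ' : ζ' ∈ blockOfR ends h u p (keyR ends U ξ l h o u p ζ))
    (hQ : ζ' ∈ tgtU ends l h {S : Set V | o ∈ S}) :
    ζ' ∈ swOutSide ends l h o U ξ ∧ keyR ends U ξ l h o u p ζ' = keyR ends U ξ l h o u p ζ := by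
  by_cases hu : u ∉ hull ends ζ h
  · rw [keyR_of_out hu] at hζ' ⊢
    obtain ⟨h1, h2, h3⟩ := (orbitKind_block hl hj.hloop_h hj.hout hζ hu).2.1 ζ' hζ' hQ
    exact ⟨h1, by rw [keyR_of_out h2, h3]⟩
  rw [not_not] at hu
  by_cases hk : hull ends ζ u ⊆ U
  · rw [keyR_of_core hu hk] at hζ' ⊢
    exact keyR_eq_of_mem_blockR_core hj hl ho hζ ⟨hu, hk⟩ hζ' hQ
  by_cases hm : MixedKindER ends U ξ l h o u p ζ
  · rw [keyR_of_escMixed hu hk hm] at hζ' ⊢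
    obtain ⟨ζ₀, hζ₀, hk₀, hdata, -⟩ := hm
    rw [← hdata] at hζ' ⊢
    exact keyR_eq_of_mem_blockR_core hj hl ho hζ₀ hk₀ hζ' hQ
  · rw [keyR_of_plain hu hk hm] at hζ' ⊢
    have hc : CoreFree ends ζ h := coreFree_of_escaping hj.hout hζ hk
    have hc₀ : CoreFree ends (allRed ends ζ h) h := coreFree_allRed hc
    have hcl₀ : allRed ends ζ h ∈ outClass ends U h ξ :=
      allRed_mem_outClass (mem_swOutSide.1 hζ).2 hc
    have hmem := hζ'
    simp only [blockOfR, orbit, Finset.mem_image, Finset.mem_univ, true_and] at hmem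
    obtain ⟨ω', rfl⟩ := hmem
    have hζ'cl : orbitReal ends (allRed ends ζ h) h ω' ∈ swOutSide ends l h o U ξ :=
      mem_swOutSide.2 ⟨hQ, orbitReal_mem_outClass hc₀ hcl₀ ω'⟩
    have hu' : u ∈ hull ends (orbitReal ends (allRed ends ζ h) h ω') h := by
      rw [hull_orbitReal hc₀, hull_allRed hc]; exact hu
    have hc' : CoreFree ends (orbitReal ends (allRed ends ζ h) h ω') h := coreFree_orbitReal hc₀ ω'
    have hall : allRed ends (orbitReal ends (allRed ends ζ h) h ω') h = allRed ends ζ h := by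
      rw [allRed_orbitReal hc₀, allRed_idem hc]
    have hζorb : ζ ∈ orbit ends (allRed ends (orbitReal ends (allRed ends ζ h) h ω') h) h := by
      rw [hall]
      obtain ⟨ω, hω⟩ := exists_orbitReal_eq (ζ₀ := allRed ends ζ h) hc rfl
      simp only [orbit, Finset.mem_image, Finset.mem_univ, true_and]
      exact ⟨ω, hω⟩
    -- `ζ'` is escaping: a core-kind orbit point would make `ζ` of the mixed kind
    have hesc' : ¬ hull ends (orbitReal ends (allRed ends ζ h) h ω') u ⊆ U := by
      intro hsub
      apply hm
      have hk' : CoreKind ends U h u (orbitReal ends (allRed ends ζ h) h ω') := ⟨hu', hsub⟩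
      refine mixedKindER_of_mem_orbit hj hl hζ'cl hk' ?_ hc' hk hζorb
      exact mem_blockR.2 ⟨qOfR ends h u p _, not_leak_of_core' (core_qOfR _),
        mixedRealR_coreBaseOf_R hj hl hζ'cl hk'⟩
    -- `ζ'` is not of the mixed kind: its block would contain `ζ`
    have hm' : ¬ MixedKindER ends U ξ l h o u p (orbitReal ends (allRed ends ζ h) h ω') := by
      rintro ⟨ζ₀, hζ₀, hk₀, -, hmem⟩
      exact hm (mixedKindER_of_mem_orbit hj hl hζ₀ hk₀ hmem hc' hk hζorb)
    exact ⟨hζ'cl, by rw [keyR_of_plain hu' hesc' hm', hall]⟩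

omit ho in
/-- **Every block of a `Q`-point satisfies the rigid inequality.** -/
theorem card_blockOfR_le {ζ : Config E} (hζ : ζ ∈ swOutSide ends l h o U ξ) {𝓔 : Set (Set E)}
    (h𝓔 : IsUpperSet 𝓔) :
    ((blockOfR ends h u p (keyR ends U ξ l h o u p ζ)).filter fun ζ' =>
        ζ' ∈ tgtU ends l h {S : Set V | o ∈ S} ∧ redEdges ends ζ' h ∈ 𝓔).card ≤
      ((blockOfR ends h u p (keyR ends U ξ l h o u p ζ)).filter fun ζ' =>
        ζ' ∈ tgtU ends l h {S : Set V | o ∈ S} ∧ blueEdges ends ζ' h ∈ 𝓔).card := by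
  by_cases hu : u ∉ hull ends ζ h
  · rw [keyR_of_out hu]
    exact (orbitKind_block hl hj.hloop_h hj.hout hζ hu).2.2 𝓔 h𝓔
  rw [not_not] at hu
  by_cases hk : hull ends ζ u ⊆ U
  · rw [keyR_of_core hu hk]
    exact card_blockR_le hj hl hζ ⟨hu, hk⟩ h𝓔
  by_cases hm : MixedKindER ends U ξ l h o u p ζ
  · rw [keyR_of_escMixed hu hk hm]
    obtain ⟨ζ₀, hζ₀, hk₀, hdata, -⟩ := hm
    show ((blockR ends u p (mixedDataR ends h u p (baseER ends U h u p ζ))).filter _).card ≤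
      ((blockR ends u p (mixedDataR ends h u p (baseER ends U h u p ζ))).filter _).card
    rw [← hdata]
    exact card_blockR_le hj hl hζ₀ hk₀ h𝓔
  · rw [keyR_of_plain hu hk hm]
    have hc : CoreFree ends ζ h := coreFree_of_escaping hj.hout hζ hk
    have hc₀ : CoreFree ends (allRed ends ζ h) h := coreFree_allRed hc
    have hcl₀ : allRed ends ζ h ∈ outClass ends U h ξ :=
      allRed_mem_outClass (mem_swOutSide.1 hζ).2 hc
    exact card_orbit_le hc₀ hj.hloop_h hcl₀ hl h𝓔

/-- **THEOREM A_sev: the rigid inequality on every several-arms junction class**, for every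
outside colouring. -/
theorem rigidOK_of_mixedJunctionR : RigidOK ends l h o U ξ :=
  rigidOK_of_blocks ξ (keyR ends U ξ l h o u p) (blockOfR ends h u p)
    (fun _ hζ => mem_blockOfR_keyR hj hl hζ)
    (fun _ hζ _ hζ' hQ => keyR_eq_of_mem_blockOfR hj hl ho hζ hζ' hQ)
    (fun _ hζ _ h𝓔 => card_blockOfR_le hj hl hζ h𝓔)

end Thm

end MixedArms

end Summit.Ventures.PercRepro2
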